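import Literature.MathematicalPhysics.QuantumFieldTheory.Balaban1983to89.B9Eq382FormRelativeNearFlat
import Literature.MathematicalPhysics.QuantumFieldTheory.Balaban1983to89.B9Thm311DeltaPrimeA
import Literature.MathematicalPhysics.QuantumFieldTheory.Balaban1983to89.B9Eq323FlatBlockPoincare
import Literature.MathematicalPhysics.QuantumFieldTheory.Balaban1983to89.B9Eq319QprimeLipschitz

/-!
# `Balaban1983to89.B9Thm311SitePrimeFormCoercive` — T. Bałaban, *Propagators for lattice gauge theories in a background field*, Commun. Math. Phys.
# **99** (1985) 389–434 [Balaban1985BackgroundPropagators] (3.24)–(3.25) p. 394, Thm 3.11 p. 416, (3.63)–(3.64) p. 402, with [Balaban1983RegularityDecay]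
# (2.27) p. 580: THE SITE OPERATOR `Δ′_a(U) = D*_U D_U + a′Q′(U)*Q′(U)` OF THE pub-balaban NE9 CHAIN IS **STRONGLY** COERCIVE —
# `γ″·(‖D_1λ‖² + (ηL)⁻²‖λ‖²) ≤ re⟨λ, Δ′_a(U)λ⟩` — at the flat background with `γ″ = 1∕(2 + 2∕a′)` (block Poincaré WITH MEANS) and at a near-flat `U`
# by the form-relative step (first-order letter defects, one `‖η⁻¹‖`, NO centre lift); along `c₁(ηL)² = c₀L^d` free of `m, L, η, c₀, c₁` — R2′ STEP
# B7′ S3b of `t4/ROUTES-NE9.md` v13.19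

statement-level skeleton of published theorems with citation tags; proofs where landed; nothing here is a claim about the Yang–Mills mass gap

PDF held: `paper:balaban1985-cmp99-background-propagators` pp. 394–395, 402, 416 (via `B9Thm311DeltaPrimeA` ∕ `B9Eq3119DeltaPiCarrier` quotations and p0005
opened by this seat); `paper:balaban1983-cmp89-regularity-decay` p. 580 via `B9Eq323FlatBlockPoincare`.  THE PRINT (verbatim): [B9] p. 394 *«Δ′_a(U) =
Δ_U + Q′(U)*a′Q′(U) (3.24) … G′ = (Δ′_a(U))⁻¹ (3.25)»*; p. 395 *«it can be easily shown that the operator Δ′_a is positive»*; Thm 3.11 p. 416 *«Δ′_a, G′,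
(Q′G′²Q′*)⁻¹, Δ_a, G are positive definite»*; [B4] (2.27) *«⟨φ, (−Δ^{η,N}_Δ + a_kP_k)φ⟩ ≥ min{π², a_k}‖φ‖²»*.

WHY THIS FILE (cell context).  ROUTES-NE9 v13.19 §L1.2 R2′ STEP B7′ S3b: the chain's `R(U)` ((3.25)) is to be controlled through the resolvents
`G′_U = Δ′_a(U)⁻¹` ((3.63)–(3.64)), which needs `Δ′_a(U)` coercive with constants free of the spacing, STRONGLY (the `‖D_1λ‖²` row feeds the
resolvent identity's first-order factors).  ne9-leaf-04's `B9Eq323FlatBlockPoincare` gives the flat form bound on `N(Q′(1))` (on the diagonal `ηL = 1`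
free of η); this lineage's (ρ′) `B9Eq319QprimeLipschitz` gives the `Q′`-defect in Hilbert currency WITHOUT a centre lift.  Here: (i) Poincaré WITH MEANS for
every `λ`; (ii) the form-relative step of `B9Eq382FormRelativeNearFlat` on the two squares of `re⟨λ, Δ′_a(U)λ⟩` (`B9Thm311DeltaPrimeA.re_inner_laplacePrimeA`);
(iii) the letters on the diagonal: `δ_D = √d‖η⁻¹‖εR` (`norm_covDerivL2K_sub_le`), `δ_{Q′} = ρ′·√(c₁∕(c₀L^d)) = ρ′(ηL)⁻¹`, `M_{Q′} = (ηL)⁻¹` — at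
`εR = K_Rαη`, `ηL = 1`: `ρ′ ≤ dK_Rα·e^{dK_Rα}`, η-free.

WHAT IS PROVED (sorry-free; 0 `def`; [folklore] lattice bookkeeping; no inequality of the papers asserted).
* §1 **`sum_norm_sq_le_poincare_mean`**: `Σ_x‖g x‖² ≤ 2·((L−1)L∕2)·Σ_b‖g(b₊) − g(b₋)‖² + 2L^d·Σ_y‖mean_{B(y)} g‖²` (any `W`-valued `g`).
* §2 `norm_sq_Qtilde_one`, **`norm_sq_le_flat_site_squares`** (`‖λ‖² ≤ (L−1)Lη²‖D_1λ‖² + 2(c₀L^d∕c₁)‖Q̃′(1)λ‖²`), **`flat_site_strong_coercive`**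
  (`(1∕(2 + 2∕a′))·(‖D_1λ‖² + (ηL)⁻²‖λ‖²) ≤ re⟨λ, Δ′_{a′}(1)λ⟩` along `c₁(ηL)² = c₀L^d`).
* §3 **`re_inner_laplacePrimeA_ge_flat_sub`** (displayed `δ_D, δ_{Q′}, M_{Q′}`):
  `re⟨λ, Δ′(1)λ⟩ − (δ_D‖D_1λ‖² + (δ_D + δ_D² + a′δ_{Q′}(2M_{Q′} + δ_{Q′}))‖λ‖²) ≤ re⟨λ, Δ′(U)λ⟩`.
* (sequel `B9Thm311SitePrimeFormCoerciveCanonical`: the `Q′`-letters in `laplacePrimeA`'s `c₁`-currency from (ρ′) + Jensen and the composed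
  `strong_site_coercive_canonical` with `δ_D, δ_{Q′}, M_{Q′}` discharged on the diagonal.)
MODEL ∕ DECLARED READINGS.  (M1) the chain's site letters (`laplacePrimeA` = `covLaplaceSiteK + a′Q̃′†Q̃′`, `Q̃′ = Q′(U)` read into `L²(T_m; c₁)`), one
averaging step, weights `c₀, c₁`, scalar `η⁻¹`.  (M2) DISPLAYED: `hRS`, the transporter closeness `εR`, the weight relation, `0 < ηL ≤ 1`.  (M3) NOT
HERE: `G′_U`'s bounds and (3.63)–(3.64) (S3d, ne9-leaf-06), `(Q′G′²Q′*)⁻¹` (S3c, ne9-leaf-01), the tower, print's decay (Thm 3.3).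
HONEST SCOPE.  [folklore] finite-lattice quadratic-form bookkeeping; «NE9 ⇐ the named binders»; NE9 NOT PRINTED ∕ NOT PROVED; NOT summit progress
(cell pub-balaban: spine PROVED 0/9; rung (B)+1 finite T⁴ — NOT infinite volume, NOT mass gap, NOT Clay; HONEST DEPENDENCY: continuum YM on T⁴ ⇐
BetaPertH ∧ nine spine estimates (0/9 proved); BetaPertH ⇐ (D1) ∧ (D4) ∧ CAP+tail; G-an2-4 gates asym, D1 and NE2/3/4).  Unit
`b2b-balaban-t4-ne9-formalise-leaf-03` (gen 62), INTENT I-ne9leaf03-g62-4 = B7′ S3b (first refusal ne9-leaf-04 released «no part of B7′ this generation»,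
journal l.45392; this seat second); NEW file; modifies nothing.  Net new unproved facts: 0.
-/

noncomputable section

open scoped BigOperators InnerProductSpace ComplexConjugate

namespace Literature.MathematicalPhysics.QuantumFieldTheory.Balaban1983to89.B9Thm311SitePrimeFormCoercive

open B4Sect5Torus (TSite)
open B9SectCLatticeCarrier (Bond shift)
open B9Eq311L2Pairing (WL2)
open B9Eq319QprimeTorus (fineP blockCoord mem_blockOf_iff)
open B11Eq103H1Complex (SiteL2K covDerivL2K equiv_covDerivL2K)
open B9Eq310HessianOperator (adTransportW)
open B9Eq326OperatorAssembly (QprimeW)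
open B9Eq3119DeltaPiCarrier (laplacePrimeA)
open B9Thm311DeltaPrimeA (re_inner_laplacePrimeA)
open B5Eq172HodgePositivity (adTransportW_one hRS_one)
open B5Eq172FlatCoercivity (card_blockOf)
open B9Eq323FlatBlockPoincare (hilbert_blockPoincare sum_internal_le)
open B9Eq319QprimeLipschitz (QprimeW_one_apply sum_norm_sq_QprimeW_sub_flat_le sum_blockOf_sum rho_nonneg)
open B9Eq373DerivativeRemainderL2 (norm_covDerivL2K_sub_le)
open B9Eq382FormRelativeNearFlat (norm_sq_sub_le)

variable {d : ℕ} (L : ℕ) [NeZero L] (m : Fin d → ℕ)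

/-! ## §1 Block Poincaré WITH MEANS, for every function (no kernel condition) -/

section Mean

variable {W : Type*} [NormedAddCommGroup W] [InnerProductSpace ℂ W] [FiniteDimensional ℂ W]

/-- **BLOCK POINCARÉ WITH MEANS**: for every `W`-valued `g` on the fine torus,
`Σ_x ‖g x‖² ≤ 2·((L−1)L∕2)·Σ_b ‖g(b₊) − g(b₋)‖² + 2·L^d·Σ_y ‖L^{−d}Σ_{x∈B(y)} g x‖²` — `g − mean∘blockCoord` has vanishing block sums, so
`B9Eq323FlatBlockPoincare.hilbert_blockPoincare` bounds it block by block through the INTERNAL bonds, on which its differences are those of `g`;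
`‖g x‖² ≤ 2‖(g − mean)x‖² + 2‖mean‖²` and `|B(y)| = L^d`. [cite: Balaban1983RegularityDecay, (2.27) p.580; Balaban1985Averaging, (2) p.17] -/
theorem sum_norm_sq_le_poincare_mean {n : ℕ} (hn : n + 1 = L) (g : TSite d (fineP L m) → W) :
    ∑ x, ‖g x‖ ^ 2 ≤ 2 * ((n : ℝ) * (n + 1) / 2) * ∑ b : Bond d (fineP L m), ‖g (shift b.2 b.1) - g b.1‖ ^ 2 +
      2 * (L : ℝ) ^ d * ∑ y : TSite d m, ‖((L : ℝ) ^ d)⁻¹ • ∑ x ∈ B9Eq319QprimeTorus.blockOf L m y, g x‖ ^ 2 := by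
  classical
  have hL0 : ((L : ℝ)) ^ d ≠ 0 := pow_ne_zero _ (Nat.cast_ne_zero.2 (NeZero.ne L))
  have hP : 0 ≤ (n : ℝ) * (n + 1) / 2 := by positivity
  -- the block means and the mean-free part
  set μ : TSite d m → W := fun y => ((L : ℝ) ^ d)⁻¹ • ∑ x ∈ B9Eq319QprimeTorus.blockOf L m y, g x with hμ
  set h : TSite d (fineP L m) → W := fun x => g x - μ (blockCoord L m x) with hh
  -- (a) the block sums of `h` vanish
  have hsum : ∀ y, ∑ x ∈ Finset.univ.filter (fun x => blockCoord L m x = y), h x = 0 := by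
    intro y
    have hB : Finset.univ.filter (fun x => blockCoord L m x = y) = B9Eq319QprimeTorus.blockOf L m y := rfl
    rw [hB, Finset.sum_sub_distrib]
    have hc : ∑ x ∈ B9Eq319QprimeTorus.blockOf L m y, μ (blockCoord L m x) = ∑ _x ∈ B9Eq319QprimeTorus.blockOf L m y, μ y :=
      Finset.sum_congr rfl fun x hx => by rw [(mem_blockOf_iff L m y x).1 hx]
    rw [hc, Finset.sum_const, card_blockOf, hμ]
    simp only
    rw [← Nat.cast_smul_eq_nsmul ℝ, smul_smul, Nat.cast_pow, mul_inv_cancel₀ hL0, one_smul, sub_self]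
  -- (b) per block, Poincaré for `h` through internal bonds, where `h`'s differences are `g`'s
  have hblock : ∀ y, ∑ x ∈ Finset.univ.filter (fun x => blockCoord L m x = y), ‖h x‖ ^ 2 ≤ (n : ℝ) * (n + 1) / 2 *
      ∑ b ∈ Finset.univ.filter (fun b : Bond d (fineP L m) => blockCoord L m b.1 = y ∧ blockCoord L m (shift b.2 b.1) = y),
        ‖g (shift b.2 b.1) - g b.1‖ ^ 2 := by
    intro y
    refine (hilbert_blockPoincare L m hn y h (hsum y)).trans (le_of_eq ?_)
    congr 1
    refine Finset.sum_congr rfl fun b hb => ?_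
    simp only [Finset.mem_filter, Finset.mem_univ, true_and] at hb
    rw [hh]
    simp only [hb.1, hb.2, sub_sub_sub_cancel_right]
  -- (c) sum over the blocks; internal bonds ≤ all bonds
  have hh2 : ∑ x, ‖h x‖ ^ 2 ≤ (n : ℝ) * (n + 1) / 2 * ∑ b : Bond d (fineP L m), ‖g (shift b.2 b.1) - g b.1‖ ^ 2 := by
    rw [← Finset.sum_fiberwise_of_maps_to (s := Finset.univ) (t := Finset.univ) (g := blockCoord L m) (fun x _ => Finset.mem_univ _)
      (fun x => ‖h x‖ ^ 2)]
    refine (Finset.sum_le_sum fun y _ => hblock y).trans ?_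
    rw [← Finset.mul_sum]
    exact mul_le_mul_of_nonneg_left (sum_internal_le (blockCoord L m) (fun b : Bond d (fineP L m) => b.1)
      (fun b : Bond d (fineP L m) => shift b.2 b.1) (fun b => ‖g (shift b.2 b.1) - g b.1‖ ^ 2) fun _ => sq_nonneg _) hP
  -- (d) `‖g x‖² ≤ 2‖h x‖² + 2‖μ(blockCoord x)‖²`
  have hsplit : ∀ x, ‖g x‖ ^ 2 ≤ 2 * ‖h x‖ ^ 2 + 2 * ‖μ (blockCoord L m x)‖ ^ 2 := fun x => by
    have e : g x = h x + μ (blockCoord L m x) := by rw [hh]; simp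
    have h1 : ‖g x‖ ≤ ‖h x‖ + ‖μ (blockCoord L m x)‖ := by rw [e]; exact norm_add_le _ _
    nlinarith [norm_nonneg (g x), norm_nonneg (h x), norm_nonneg (μ (blockCoord L m x)), sq_nonneg (‖h x‖ - ‖μ (blockCoord L m x)‖)]
  -- (e) `Σ_x ‖μ(blockCoord x)‖² = L^d·Σ_y ‖μ y‖²`
  have hmean : ∑ x, ‖μ (blockCoord L m x)‖ ^ 2 = (L : ℝ) ^ d * ∑ y : TSite d m, ‖μ y‖ ^ 2 := by
    rw [← sum_blockOf_sum L m (fun x => ‖μ (blockCoord L m x)‖ ^ 2), Finset.mul_sum]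
    refine Finset.sum_congr rfl fun y _ => ?_
    have hc : ∑ x ∈ B9Eq319QprimeTorus.blockOf L m y, ‖μ (blockCoord L m x)‖ ^ 2 = ∑ _x ∈ B9Eq319QprimeTorus.blockOf L m y, ‖μ y‖ ^ 2 :=
      Finset.sum_congr rfl fun x hx => by rw [(mem_blockOf_iff L m y x).1 hx]
    rw [hc, Finset.sum_const, card_blockOf, nsmul_eq_mul, Nat.cast_pow]
  calc ∑ x, ‖g x‖ ^ 2 ≤ ∑ x, (2 * ‖h x‖ ^ 2 + 2 * ‖μ (blockCoord L m x)‖ ^ 2) := Finset.sum_le_sum fun x _ => hsplit x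
    _ = 2 * ∑ x, ‖h x‖ ^ 2 + 2 * ∑ x, ‖μ (blockCoord L m x)‖ ^ 2 := by
        rw [Finset.sum_add_distrib, Finset.mul_sum, Finset.mul_sum]
    _ ≤ 2 * ((n : ℝ) * (n + 1) / 2 * ∑ b : Bond d (fineP L m), ‖g (shift b.2 b.1) - g b.1‖ ^ 2) + 2 * ((L : ℝ) ^ d * ∑ y : TSite d m, ‖μ y‖ ^ 2) := by
        rw [hmean]; linarith [hh2]
    _ = _ := by rw [hμ]; ring

end Mean

/-! ## §2 The chain's site letters at the flat background: Poincaré with means and the STRONG flat form of `Δ′_a(1)` -/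

section Flat

variable {𝔸 : Type*} [Ring 𝔸] [Algebra ℂ 𝔸]
  {W : Type*} [NormedAddCommGroup W] [InnerProductSpace ℂ W] [FiniteDimensional ℂ W] (φ : W ≃ₗ[ℂ] 𝔸)
  {c₀ c₁ : ℝ} [Fact (0 < c₀)] [Fact (0 < c₁)] {η : ℝ} (hη : η ≠ 0)

omit [FiniteDimensional ℂ W] [Fact (0 < c₀)] in
/-- The `c₁`-weighted reading `Q̃′(1)λ` of the flat gauge-parameter averaging has squared norm `c₁·Σ_y ‖L^{−d}Σ_{x∈B(y)} λ x‖²`.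
[cite: Balaban1985BackgroundPropagators, (3.19) p.393, (3.24) p.394] -/
theorem norm_sq_Qtilde_one (lam : SiteL2K ℂ d (fineP L m) c₀ W) :
    ‖((WL2.linearEquiv ℂ ℂ (fun _ : TSite d m => c₁)).symm.toLinearMap ∘ₗ QprimeW L m φ (fun _ : Bond d (fineP L m) => (1 : 𝔸ˣ))) lam‖ ^ 2 =
      c₁ * ∑ y : TSite d m, ‖((L : ℝ) ^ d)⁻¹ • ∑ x ∈ B9Eq319QprimeTorus.blockOf L m y, WL2.equiv ℂ (fun _ : TSite d (fineP L m) => c₀) W lam x‖ ^ 2 := by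
  rw [WL2.norm_sq (𝕜 := ℂ) (w := fun _ : TSite d m => c₁) (V := W), Finset.mul_sum]
  refine Finset.sum_congr rfl fun y _ => ?_
  rw [LinearMap.comp_apply]
  simp only [LinearEquiv.coe_coe, WL2.linearEquiv_symm_apply, Equiv.apply_symm_apply]
  rw [QprimeW_one_apply, ← Finset.smul_sum]
  rfl

include hη in
/-- **POINCARÉ WITH MEANS AT THE CHAIN's LETTERS**: for EVERY gauge parameter `λ` (no kernel condition),
`‖λ‖² ≤ (L−1)L·η²·‖D_1λ‖² + 2·(c₀L^d∕c₁)·‖Q̃′(1)λ‖²` — §1 read through `‖λ‖² = c₀Σ‖λ x‖²`, `‖D_1λ‖² = c₀η⁻²Σ_b‖λ(b₊) − λ(b₋)‖²`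
(`covDeriv_apply_dir` at the identity transporters) and `norm_sq_Qtilde_one`; uniform in the volume. [cite: Balaban1983RegularityDecay, (2.27) p.580; Balaban1985BackgroundPropagators, (3.3) p.391, (3.24) p.394] -/
theorem norm_sq_le_flat_site_squares (lam : SiteL2K ℂ d (fineP L m) c₀ W) :
    ‖lam‖ ^ 2 ≤ ((L : ℝ) - 1) * L * η ^ 2 * ‖covDerivL2K ℂ c₀ ((η : ℂ))⁻¹ (adTransportW φ (fun _ : Bond d (fineP L m) => (1 : 𝔸ˣ))) lam‖ ^ 2 +
      2 * (c₀ * (L : ℝ) ^ d / c₁) *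
        ‖((WL2.linearEquiv ℂ ℂ (fun _ : TSite d m => c₁)).symm.toLinearMap ∘ₗ QprimeW L m φ (fun _ : Bond d (fineP L m) => (1 : 𝔸ˣ))) lam‖ ^ 2 := by
  have hc₀ : 0 < c₀ := Fact.out
  have hc₁ : 0 < c₁ := Fact.out
  set g := WL2.equiv ℂ (fun _ : TSite d (fineP L m) => c₀) W lam with hg
  have hn : L - 1 + 1 = L := Nat.sub_add_cancel (Nat.one_le_iff_ne_zero.2 (NeZero.ne L))
  have hcast : ((L - 1 : ℕ) : ℝ) = (L : ℝ) - 1 := by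
    rw [Nat.cast_sub (Nat.one_le_iff_ne_zero.2 (NeZero.ne L)), Nat.cast_one]
  have hP := sum_norm_sq_le_poincare_mean L m hn g
  rw [hcast, sub_add_cancel] at hP
  have hl : ‖lam‖ ^ 2 = c₀ * ∑ x, ‖g x‖ ^ 2 := by
    rw [WL2.norm_sq (𝕜 := ℂ) (w := fun _ : TSite d (fineP L m) => c₀) (V := W), Finset.mul_sum]
  have hD : ‖covDerivL2K ℂ c₀ ((η : ℂ))⁻¹ (adTransportW φ (fun _ : Bond d (fineP L m) => (1 : 𝔸ˣ))) lam‖ ^ 2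
      = c₀ * (η ^ 2)⁻¹ * ∑ b : Bond d (fineP L m), ‖g (shift b.2 b.1) - g b.1‖ ^ 2 := by
    rw [WL2.norm_sq (𝕜 := ℂ) (w := fun _ : Bond d (fineP L m) => c₀) (V := W), Finset.mul_sum, Fintype.sum_prod_type, Fintype.sum_prod_type]
    refine Finset.sum_congr rfl fun x _ => Finset.sum_congr rfl fun μ _ => ?_
    rw [equiv_covDerivL2K, B9Eq33CovDerivVector.covDeriv_apply_dir, adTransportW_one, LinearMap.id_apply, norm_smul, norm_inv,
      Complex.norm_real, Real.norm_eq_abs, mul_pow, inv_pow, sq_abs]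
    ring
  have hQ := norm_sq_Qtilde_one L m φ (c₀ := c₀) (c₁ := c₁) lam
  rw [hl, hD, hQ]
  have hη2 : η ^ 2 ≠ 0 := pow_ne_zero _ hη
  have hrew : ((L : ℝ) - 1) * L * η ^ 2 * (c₀ * (η ^ 2)⁻¹ * ∑ b : Bond d (fineP L m), ‖g (shift b.2 b.1) - g b.1‖ ^ 2) +
      2 * (c₀ * (L : ℝ) ^ d / c₁) * (c₁ * ∑ y : TSite d m, ‖((L : ℝ) ^ d)⁻¹ • ∑ x ∈ B9Eq319QprimeTorus.blockOf L m y, g x‖ ^ 2) =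
      c₀ * (2 * (((L : ℝ) - 1) * (L : ℝ) / 2) * ∑ b : Bond d (fineP L m), ‖g (shift b.2 b.1) - g b.1‖ ^ 2 +
        2 * (L : ℝ) ^ d * ∑ y : TSite d m, ‖((L : ℝ) ^ d)⁻¹ • ∑ x ∈ B9Eq319QprimeTorus.blockOf L m y, g x‖ ^ 2) := by
    have e1 : ((L : ℝ) - 1) * L * η ^ 2 * (c₀ * (η ^ 2)⁻¹ * ∑ b : Bond d (fineP L m), ‖g (shift b.2 b.1) - g b.1‖ ^ 2) =
        c₀ * (((L : ℝ) - 1) * L) * (η ^ 2 * (η ^ 2)⁻¹) * ∑ b : Bond d (fineP L m), ‖g (shift b.2 b.1) - g b.1‖ ^ 2 := by ring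
    have e2 : 2 * (c₀ * (L : ℝ) ^ d / c₁) * (c₁ * ∑ y : TSite d m, ‖((L : ℝ) ^ d)⁻¹ • ∑ x ∈ B9Eq319QprimeTorus.blockOf L m y, g x‖ ^ 2) =
        2 * c₀ * (L : ℝ) ^ d * (c₁ / c₁) * ∑ y : TSite d m, ‖((L : ℝ) ^ d)⁻¹ • ∑ x ∈ B9Eq319QprimeTorus.blockOf L m y, g x‖ ^ 2 := by ring
    rw [e1, e2, mul_inv_cancel₀ hη2, div_self hc₁.ne']
    ring
  rw [hrew]
  exact mul_le_mul_of_nonneg_left hP hc₀.le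

include hη in
/-- **THE STRONG FLAT FORM OF `Δ′_{a′}(1)` ALONG BAŁABAN's NORMALISATION**: with `c₁(ηL)² = c₀L^d` (`c₀L^d∕c₁ = (ηL)²`), `0 < ηL` and `a′ > 0`,
`(1∕(2 + 2∕a′))·(‖D_1λ‖² + (ηL)⁻²‖λ‖²) ≤ re⟨λ, Δ′_{a′}(1)λ⟩ = ‖D_1λ‖² + a′‖Q̃′(1)λ‖²` (`B9Thm311DeltaPrimeA.re_inner_laplacePrimeA` at the flat `hRS`)
— cf. [B4] (2.27)'s `min{π², a_k}`; constant free of `m, L, η, c₀, c₁`. [cite: Balaban1985BackgroundPropagators, (3.24) p.394, p.395, Thm 3.11 p.416; Balaban1983RegularityDecay, (2.27) p.580] -/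
theorem flat_site_strong_coercive {a' : ℝ} (ha' : 0 < a') (hηL0 : 0 < η * L) (hs : c₁ * (η * L) ^ 2 = c₀ * (L : ℝ) ^ d)
    (lam : SiteL2K ℂ d (fineP L m) c₀ W) :
    (1 / (2 + 2 / a')) * (‖covDerivL2K ℂ c₀ ((η : ℂ))⁻¹ (adTransportW φ (fun _ : Bond d (fineP L m) => (1 : 𝔸ˣ))) lam‖ ^ 2 +
        ((η * L)⁻¹) ^ 2 * ‖lam‖ ^ 2) ≤
      RCLike.re ⟪lam, laplacePrimeA L m φ η (fun _ : Bond d (fineP L m) => (1 : 𝔸ˣ)) a' (c₁ := c₁) lam⟫_ℂ := by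
  have hc₀ : 0 < c₀ := Fact.out
  have hc₁ : 0 < c₁ := Fact.out
  have hLr : (0 : ℝ) < L := by exact_mod_cast Nat.pos_of_ne_zero (NeZero.ne L)
  rw [re_inner_laplacePrimeA L m φ η (fun _ : Bond d (fineP L m) => (1 : 𝔸ˣ)) a' (hRS_one φ)]
  set D := ‖covDerivL2K ℂ c₀ ((η : ℂ))⁻¹ (adTransportW φ (fun _ : Bond d (fineP L m) => (1 : 𝔸ˣ))) lam‖ ^ 2 with hDdef
  set Q := ‖((WL2.linearEquiv ℂ ℂ (fun _ : TSite d m => c₁)).symm.toLinearMap ∘ₗ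
    QprimeW L m φ (fun _ : Bond d (fineP L m) => (1 : 𝔸ˣ))) lam‖ ^ 2 with hQdef
  have hP := norm_sq_le_flat_site_squares L m φ (c₁ := c₁) hη lam
  rw [← hDdef, ← hQdef] at hP
  have hratio : c₀ * (L : ℝ) ^ d / c₁ = (η * L) ^ 2 := by rw [← hs]; field_simp
  rw [hratio] at hP
  have hD0 : 0 ≤ D := by rw [hDdef]; positivity
  have hQ0 : 0 ≤ Q := by rw [hQdef]; positivity
  have hηL2 : 0 < (η * L) ^ 2 := by positivity
  have hinv : ((η * L)⁻¹) ^ 2 * (η * L) ^ 2 = 1 := by rw [inv_pow, inv_mul_cancel₀ hηL2.ne']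
  -- `(ηL)⁻²‖λ‖² ≤ (L−1)∕L·D + 2Q ≤ D + 2Q`
  have hmass : ((η * L)⁻¹) ^ 2 * ‖lam‖ ^ 2 ≤ D + 2 * Q := by
    have h1 : ((η * L)⁻¹) ^ 2 * ‖lam‖ ^ 2 ≤ ((η * L)⁻¹) ^ 2 * (((L : ℝ) - 1) * L * η ^ 2 * D + 2 * (η * L) ^ 2 * Q) :=
      mul_le_mul_of_nonneg_left hP (by positivity)
    have h2 : ((η * L)⁻¹) ^ 2 * (((L : ℝ) - 1) * L * η ^ 2 * D + 2 * (η * L) ^ 2 * Q) = ((L : ℝ) - 1) / L * D + 2 * Q := by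
      field_simp
    have h3 : ((L : ℝ) - 1) / L * D ≤ D := by
      have : ((L : ℝ) - 1) / L ≤ 1 := by rw [div_le_one hLr]; linarith
      exact (mul_le_mul_of_nonneg_right this hD0).trans (by rw [one_mul])
    linarith
  have ha2 : 0 < 2 + 2 / a' := by positivity
  rw [one_div, inv_mul_le_iff₀ ha2]
  have hexp : (2 + 2 / a') * (D + a' * Q) = 2 * D + 2 * Q + (2 / a') * D + 2 * (a' * Q) := by
    field_simp
    ring
  rw [hexp]
  have h4 : 0 ≤ (2 / a') * D := by positivity
  have h5 : 0 ≤ a' * Q := by positivity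
  linarith [hmass]

end Flat

/-! ## §3 The form-relative near-flat step for `Δ′_a(U)` (letter defects DISPLAYED) -/

section Near

variable {𝔸 : Type*} [Ring 𝔸] [Algebra ℂ 𝔸]
  {W : Type*} [NormedAddCommGroup W] [InnerProductSpace ℂ W] [FiniteDimensional ℂ W] (φ : W ≃ₗ[ℂ] 𝔸)
  {c₀ c₁ : ℝ} [Fact (0 < c₀)] [Fact (0 < c₁)] (η : ℝ) {a' : ℝ} (ha' : 0 ≤ a') (U : Bond d (fineP L m) → 𝔸ˣ)
  (hRS : ∀ (b : Bond d (fineP L m)) (v u : W), ⟪adTransportW φ U b v, u⟫_ℂ = ⟪v, adTransportW φ (fun b => (U b)⁻¹) b u⟫_ℂ)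
  {δD δQ MQ : ℝ} (hδD : 0 ≤ δD) (hδQ : 0 ≤ δQ)
  (hD : ∀ l : SiteL2K ℂ d (fineP L m) c₀ W, ‖covDerivL2K ℂ c₀ ((η : ℂ))⁻¹ (adTransportW φ U) l -
    covDerivL2K ℂ c₀ ((η : ℂ))⁻¹ (adTransportW φ (fun _ : Bond d (fineP L m) => (1 : 𝔸ˣ))) l‖ ≤ δD * ‖l‖)
  (hQ : ∀ l : SiteL2K ℂ d (fineP L m) c₀ W,
    ‖((WL2.linearEquiv ℂ ℂ (fun _ : TSite d m => c₁)).symm.toLinearMap ∘ₗ QprimeW L m φ U) l -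
      ((WL2.linearEquiv ℂ ℂ (fun _ : TSite d m => c₁)).symm.toLinearMap ∘ₗ QprimeW L m φ (fun _ : Bond d (fineP L m) => (1 : 𝔸ˣ))) l‖ ≤ δQ * ‖l‖)
  (hQ₁ : ∀ l : SiteL2K ℂ d (fineP L m) c₀ W,
    ‖((WL2.linearEquiv ℂ ℂ (fun _ : TSite d m => c₁)).symm.toLinearMap ∘ₗ QprimeW L m φ (fun _ : Bond d (fineP L m) => (1 : 𝔸ˣ))) l‖ ≤ MQ * ‖l‖)

include ha' hRS hδD hδQ hD hQ hQ₁

/-- **THE FORM-RELATIVE NEAR-FLAT STEP FOR THE SITE OPERATOR**: with the derivative defect `δ_D`, the `Q′`-defect `δ_{Q′}` and the flat norm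
`M_{Q′}` (both in `laplacePrimeA`'s `c₁`-weighted currency) DISPLAYED,
`re⟨λ, Δ′_{a′}(1)λ⟩ − (δ_D‖D_1λ‖² + (δ_D + δ_D² + a′δ_{Q′}(2M_{Q′} + δ_{Q′}))‖λ‖²) ≤ re⟨λ, Δ′_{a′}(U)λ⟩` — the two squares of
`re_inner_laplacePrimeA` at `U` and at `1`, `B9Eq382FormRelativeNearFlat.norm_sq_sub_le` on each, Young. FIRST order in the derivative letter.
[cite: Balaban1985BackgroundPropagators, (3.24) p.394, (3.63)–(3.64) p.402, Thm 3.11 p.416] -/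
theorem re_inner_laplacePrimeA_ge_flat_sub (lam : SiteL2K ℂ d (fineP L m) c₀ W) :
    RCLike.re ⟪lam, laplacePrimeA L m φ η (fun _ : Bond d (fineP L m) => (1 : 𝔸ˣ)) a' (c₁ := c₁) lam⟫_ℂ -
        (δD * ‖covDerivL2K ℂ c₀ ((η : ℂ))⁻¹ (adTransportW φ (fun _ : Bond d (fineP L m) => (1 : 𝔸ˣ))) lam‖ ^ 2 +
          (δD + δD ^ 2 + a' * δQ * (2 * MQ + δQ)) * ‖lam‖ ^ 2) ≤
      RCLike.re ⟪lam, laplacePrimeA L m φ η U a' (c₁ := c₁) lam⟫_ℂ := by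
  rw [re_inner_laplacePrimeA L m φ η U a' hRS, re_inner_laplacePrimeA L m φ η (fun _ : Bond d (fineP L m) => (1 : 𝔸ˣ)) a' (hRS_one φ)]
  set dU := covDerivL2K ℂ c₀ ((η : ℂ))⁻¹ (adTransportW φ U) lam with hdU
  set d1 := covDerivL2K ℂ c₀ ((η : ℂ))⁻¹ (adTransportW φ (fun _ : Bond d (fineP L m) => (1 : 𝔸ˣ))) lam with hd1
  set qU := ((WL2.linearEquiv ℂ ℂ (fun _ : TSite d m => c₁)).symm.toLinearMap ∘ₗ QprimeW L m φ U) lam with hqU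
  set q1 := ((WL2.linearEquiv ℂ ℂ (fun _ : TSite d m => c₁)).symm.toLinearMap ∘ₗ
    QprimeW L m φ (fun _ : Bond d (fineP L m) => (1 : 𝔸ˣ))) lam with hq1
  have hder : ‖d1‖ ^ 2 - ‖dU‖ ^ 2 ≤ δD * ‖lam‖ * (2 * ‖d1‖ + δD * ‖lam‖) := by
    have h := norm_sq_sub_le dU d1
    have hd : ‖dU - d1‖ ≤ δD * ‖lam‖ := hD lam
    have h0 : 0 ≤ ‖dU - d1‖ := norm_nonneg _
    exact h.trans (mul_le_mul hd (by linarith) (by positivity) (by positivity))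
  have havg : ‖q1‖ ^ 2 - ‖qU‖ ^ 2 ≤ δQ * ‖lam‖ * (2 * (MQ * ‖lam‖) + δQ * ‖lam‖) := by
    have h := norm_sq_sub_le qU q1
    have hd : ‖qU - q1‖ ≤ δQ * ‖lam‖ := hQ lam
    have h0 : 0 ≤ ‖qU - q1‖ := norm_nonneg _
    have hq : ‖q1‖ ≤ MQ * ‖lam‖ := hQ₁ lam
    exact h.trans (mul_le_mul hd (by linarith) (by positivity) (by positivity))
  have hy : 2 * ‖lam‖ * ‖d1‖ ≤ ‖lam‖ ^ 2 + ‖d1‖ ^ 2 := by nlinarith [sq_nonneg (‖lam‖ - ‖d1‖)]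
  have p1 : δD * (2 * ‖lam‖ * ‖d1‖) ≤ δD * (‖lam‖ ^ 2 + ‖d1‖ ^ 2) := mul_le_mul_of_nonneg_left hy hδD
  have havg' : a' * (‖q1‖ ^ 2 - ‖qU‖ ^ 2) ≤ a' * (δQ * ‖lam‖ * (2 * (MQ * ‖lam‖) + δQ * ‖lam‖)) := mul_le_mul_of_nonneg_left havg ha'
  have e1 : δD * ‖lam‖ * (2 * ‖d1‖ + δD * ‖lam‖) = δD * (2 * ‖lam‖ * ‖d1‖) + δD ^ 2 * ‖lam‖ ^ 2 := by ring
  have e2 : a' * (δQ * ‖lam‖ * (2 * (MQ * ‖lam‖) + δQ * ‖lam‖)) = a' * δQ * (2 * MQ + δQ) * ‖lam‖ ^ 2 := by ring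
  nlinarith [hder, havg', p1, e1, e2]

end Near

end Literature.MathematicalPhysics.QuantumFieldTheory.Balaban1983to89.B9Thm311SitePrimeFormCoercive

end
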